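import Summits.AtomisticToContinuum.Crystallization.Theorems.GappedShellCensusCleanLimitsHaveWindowsCleanChartTSteps1
import Summits.AtomisticToContinuum.Crystallization.Theorems.GappedShellCensusCleanLimitsHaveWindowsCleanChartTGlobalA
import Summits.AtomisticToContinuum.Crystallization.Theorems.GappedShellCensusCleanLimitsHaveWindowsCleanChartTGlobalB
import Summits.AtomisticToContinuum.Crystallization.Theorems.PalmUnimodularRigidityShellsToBarlowChartTransportGlobalC

/-!
# `CleanLimitsHaveWindows` (stmt-AtomisticToContinuum-15932), line `Sketch` — stub K1 (`stub_cleanChart`):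
# the transport development re-run on CLEAN charts — copy of `PalmUnimodularRigidityShellsToBarlowChartTransportGlobalC`

This file is a mechanical copy of `Theorems/PalmUnimodularRigidityShellsToBarlowChartTransportGlobalC.lean` (crux `ShellsToBarlowChart`,
route `PalmUnimodularRigidity`; original title: Line `develop-the-model-growth-descent` (crux `ShellsToBarlowChart`, stmt-AtomisticToContinuum-9227): all layers of the development)
in which the chart hypothesis `hch : ∀ z ∈ S, IsZChart S z (ac z) (Pc z) (Ac z) (nb z)` (integer charts with
`1 %` closeness) is replaced by the CLEAN-CHART hypothesis: at every site a labelling of the bonded neighbours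
by `fcc3Int`/`hcpInt`, bijective, with bonds among neighbours = label pairs at squared distance `18`, together
with the TRANSFER property across every bond (proved for clean sets at matching radius `1/5` in
`…CleanChartTransfer`).  The original development uses its metric hypothesis only through the transfer
lemma, so all proofs go through verbatim; declarations live in the sub-namespace `….Clean` and shadow the
originals, the `hch`-free lemmas of the original file are reused, not restated.  All `[folklore]`.
-/

noncomputable section

namespace Summit.AtomisticToContinuum.Crystallization.Theorems.PalmUnimodularRigidityShellsToBarlowChart.Clean

open Literature.Geometry.DiscreteGeometry Literature.MathematicalPhysics.StatisticalMechanics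
open Summit.AtomisticToContinuum.Crystallization.Theorems.ShellsToBarlowChartNegative

variable {S : Set (EuclideanSpace ℝ (Fin 3))} {Pc : (EuclideanSpace ℝ (Fin 3)) → Finset (Fin 3 → ℤ)}
  {nb : (EuclideanSpace ℝ (Fin 3)) → (Fin 3 → ℤ) → (EuclideanSpace ℝ (Fin 3))}

/-- **All layers of the development are valid and coherent**, and the letters match across
layers: the letter read below layer `n+1` is the parity of layer `n`, the parity of layer
`−(m+1)` is the letter read below layer `−m`. [folklore] -/
theorem layers (hch : ((∀ z ∈ S, (Pc z = fcc3Int ∨ Pc z = hcpInt) ∧ Set.BijOn (nb z) (↑(Pc z) : Set (Fin 3 → ℤ)) {y | y ∈ S ∧ (0 < dist z y ∧ dist z y ≤ 28 / 25)} ∧ (∀ t ∈ Pc z, ∀ t' ∈ Pc z, ((0 < dist (nb z t) (nb z t') ∧ dist (nb z t) (nb z t') ≤ 28 / 25) ↔ sqNormInt (t - t') = 18))) ∧ (∀ x ∈ S, ∀ y ∈ S, (0 < dist x y ∧ dist x y ≤ 28 / 25) → ∀ t ∈ Pc x, ∀ t' ∈ Pc x, ∀ u ∈ Pc y, ∀ u'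 ∈ Pc y, nb y u = nb x t → nb y u' = nb x t' → sqNormInt (u - u') = sqNormInt (t - t')))) {g₀ : ZFrame}
    (h₀ : IsFrame (Pc g₀.pt) g₀.t₁ g₀.t₂ g₀.U) (h₀S : g₀.pt ∈ S) (h₀p : frameParity g₀.t₁ g₀.t₂ g₀.U = 1)
    (h₀A : (∀ z ∈ S, Pc z = fcc3Int) ∨ Pc g₀.pt = hcpInt) :
    (∀ k i j : ℤ, IsFrame (Pc (frameAt Pc nb g₀ k i j).pt) (frameAt Pc nb g₀ k i j).t₁ (frameAt Pc nb g₀ k i j).t₂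
        (frameAt Pc nb g₀ k i j).U) ∧
    (∀ k i j : ℤ, (frameAt Pc nb g₀ k i j).pt ∈ S) ∧
    (∀ k i j : ℤ, frameAt Pc nb g₀ k (i + 1) j = Istep Pc nb (frameAt Pc nb g₀ k i j)) ∧
    (∀ k i j : ℤ, frameAt Pc nb g₀ k i (j + 1) = Jstep Pc nb (frameAt Pc nb g₀ k i j)) ∧
    (∀ (n : ℕ) (i j : ℤ), lowerParity (frameAt Pc nb g₀ ((n : ℤ) + 1) i j).t₁ (frameAt Pc nb g₀ ((n : ℤ) + 1) i j).t₂
        (lowerCap (Pc (frameAt Pc nb g₀ ((n : ℤ) + 1) i j).pt) (frameAt Pc nb g₀ ((n : ℤ) + 1) i j).t₁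
          (frameAt Pc nb g₀ ((n : ℤ) + 1) i j).t₂ (frameAt Pc nb g₀ ((n : ℤ) + 1) i j).U) =
        frameParity (frameAt Pc nb g₀ n i j).t₁ (frameAt Pc nb g₀ n i j).t₂ (frameAt Pc nb g₀ n i j).U) ∧
    (∀ (m : ℕ) (i j : ℤ), frameParity (frameAt Pc nb g₀ (-((m : ℤ) + 1)) i j).t₁ (frameAt Pc nb g₀ (-((m : ℤ) + 1)) i j).t₂
        (frameAt Pc nb g₀ (-((m : ℤ) + 1)) i j).U =
        lowerParity (frameAt Pc nb g₀ (-(m : ℤ)) i j).t₁ (frameAt Pc nb g₀ (-(m : ℤ)) i j).t₂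
          (lowerCap (Pc (frameAt Pc nb g₀ (-(m : ℤ)) i j).pt) (frameAt Pc nb g₀ (-(m : ℤ)) i j).t₁
            (frameAt Pc nb g₀ (-(m : ℤ)) i j).t₂ (frameAt Pc nb g₀ (-(m : ℤ)) i j).U)) := by
  -- the layer predicate
  let OK : ℤ → Prop := fun k =>
    (∀ i j : ℤ, IsFrame (Pc (frameAt Pc nb g₀ k i j).pt) (frameAt Pc nb g₀ k i j).t₁ (frameAt Pc nb g₀ k i j).t₂
        (frameAt Pc nb g₀ k i j).U) ∧
    (∀ i j : ℤ, (frameAt Pc nb g₀ k i j).pt ∈ S) ∧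
    (∀ i j : ℤ, frameAt Pc nb g₀ k (i + 1) j = Istep Pc nb (frameAt Pc nb g₀ k i j)) ∧
    (∀ i j : ℤ, frameAt Pc nb g₀ k i (j + 1) = Jstep Pc nb (frameAt Pc nb g₀ k i j))
  have h0 : OK 0 := by
    obtain ⟨a, b, c, d, -⟩ := layer_zero (Pc := Pc) (nb := nb) hch h₀ h₀S h₀p h₀A
    exact ⟨a, b, c, d⟩
  have hup : ∀ n : ℕ, OK n → OK ((n : ℤ) + 1) ∧
      ∀ i j : ℤ, lowerParity (frameAt Pc nb g₀ ((n : ℤ) + 1) i j).t₁ (frameAt Pc nb g₀ ((n : ℤ) + 1) i j).t₂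
        (lowerCap (Pc (frameAt Pc nb g₀ ((n : ℤ) + 1) i j).pt) (frameAt Pc nb g₀ ((n : ℤ) + 1) i j).t₁
          (frameAt Pc nb g₀ ((n : ℤ) + 1) i j).t₂ (frameAt Pc nb g₀ ((n : ℤ) + 1) i j).U) =
        frameParity (frameAt Pc nb g₀ n i j).t₁ (frameAt Pc nb g₀ n i j).t₂ (frameAt Pc nb g₀ n i j).U := by
    rintro n ⟨a, b, c, d⟩
    obtain ⟨a', b', c', d', e'⟩ := layer_up hch (Φ := fun i j => frameAt Pc nb g₀ n i j) a b c d
    refine ⟨⟨fun i j => ?_, fun i j => ?_, fun i j => ?_, fun i j => ?_⟩, fun i j => ?_⟩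
    · rw [frameAt_natSucc]; exact a' i j
    · rw [frameAt_natSucc]; exact b' i j
    · rw [frameAt_natSucc, frameAt_natSucc]; exact c' i j
    · rw [frameAt_natSucc, frameAt_natSucc]; exact d' i j
    · rw [frameAt_natSucc]; exact e' i j
  have hdown : ∀ m : ℕ, OK (-(m : ℤ)) → OK (-((m : ℤ) + 1)) ∧
      ∀ i j : ℤ, frameParity (frameAt Pc nb g₀ (-((m : ℤ) + 1)) i j).t₁ (frameAt Pc nb g₀ (-((m : ℤ) + 1)) i j).t₂
        (frameAt Pc nb g₀ (-((m : ℤ) + 1)) i j).U =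
        lowerParity (frameAt Pc nb g₀ (-(m : ℤ)) i j).t₁ (frameAt Pc nb g₀ (-(m : ℤ)) i j).t₂
          (lowerCap (Pc (frameAt Pc nb g₀ (-(m : ℤ)) i j).pt) (frameAt Pc nb g₀ (-(m : ℤ)) i j).t₁
            (frameAt Pc nb g₀ (-(m : ℤ)) i j).t₂ (frameAt Pc nb g₀ (-(m : ℤ)) i j).U) := by
    rintro m ⟨a, b, c, d⟩
    obtain ⟨a', b', c', d', e'⟩ := layer_down hch (Φ := fun i j => frameAt Pc nb g₀ (-(m : ℤ)) i j) a b c d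
    refine ⟨⟨fun i j => ?_, fun i j => ?_, fun i j => ?_, fun i j => ?_⟩, fun i j => ?_⟩
    · rw [frameAt_negSucc]; exact a' i j
    · rw [frameAt_negSucc]; exact b' i j
    · rw [frameAt_negSucc, frameAt_negSucc]; exact c' i j
    · rw [frameAt_negSucc, frameAt_negSucc]; exact d' i j
    · rw [frameAt_negSucc]; exact e' i j
  have hnat : ∀ n : ℕ, OK n := by
    intro n; induction n with
    | zero => exact h0
    | succ m ih => have := (hup m ih).1; push_cast; exact this
  have hneg : ∀ m : ℕ, OK (-(m : ℤ)) := by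
    intro m; induction m with
    | zero => simpa using h0
    | succ m ih => have := (hdown m ih).1; push_cast; exact this
  have hall : ∀ k : ℤ, OK k := by
    intro k
    rcases int_cases k with ⟨n, rfl⟩ | ⟨n, rfl⟩
    · exact hnat n
    · have := hneg (n + 1); push_cast at this; exact this
  exact ⟨fun k => (hall k).1, fun k => (hall k).2.1, fun k => (hall k).2.2.1, fun k => (hall k).2.2.2,
    fun n => (hup n (hnat n)).2, fun m => (hdown m (hneg m)).2⟩

end Summit.AtomisticToContinuum.Crystallization.Theorems.PalmUnimodularRigidityShellsToBarlowChart.Clean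

end
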